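import Literature.AlgebraicGeometry.ComplexMultiplication.QuadraticSubfieldFibres
import Literature.AlgebraicGeometry.Pohlmann1968.CMFamilyRankSubfamilies
import HarnessLib

/-!
# MULTI-FIELD WEIL ENGINE — CURVE ABSORPTION: a CM elliptic curve whose field embeds in a member field of ODD relative degree adds NOTHING to
# the Mumford–Tate rank of ANY family containing that member (unconditional)

Cell `pub-hodgecm2` (COR-CM), seat b30 gen 34 (2026-08-24); count-neutral own lane MULTI-FIELD WEIL ENGINE (stem `MultiFieldWeil*`).  Theorems only; no definition,
no named fact, no `sorry`.  HONEST FRAMING: UNCONDITIONAL statements about the rank `cmFamilyRank` of a family of CM types (= `dim MT(∏_i A_i)`, Deligne I Ex. 3.7 (c));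
nothing here is a step of the summit chain; `HC_CM` is NOT proved and not asserted.

THE POINT.  Seat b16's census and this engine sort the factors of a product of CM abelian varieties into BLOCKS and glue the Hodge conjecture along the rank
equation `rank(Σ) + |C| = Σ_c rank(Σ|_c) + 1` (`Hg(∏_i A_i) = ∏_c Hg(block c)`; b16's `hodgeConjectureFor_biproduct_of_cmFamilyRank_fiber_add_card_eq`).  The rank
equation has so far been obtained only from the SLOT CRITERION (p2's `cmFamilyRank_add_card_eq_of_pairwise_slots_fiber`: no two slots of different blocks share a
constituent).  That criterion cannot place a CM elliptic curve `E′` (field `k′`) next to a threefold `T₀` (field `K₀ ⊇ k′`) AGAINST a threefold `T₁` whose field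
`K₁ = k₁·F₀` is the sister of `K₀ = k′·F₀` inside one Galois closure (`k₁ = ℚ(√(−d′·disc F₀))`): the slots `T₀`, `T₁` share the constituent `χ_{k′} ⊗ std_{F₀}`
(gen 33's honest limit).  The way round it is to stop looking at the curve as a slot:

> **CURVE ABSORPTION** (§2–§3, `cmFamilyRank_comp_eq_of_quadratic_slot_of_odd`).  Let `(Φ_i)_{i ∈ I}` be CM types of CM fields `K_i`, `i₀` a slot with
> `[K_{i₀} : ℚ] = 2` and `i₁` a slot with `k′ = K_{i₀} ↪ K_{i₁}` and `[K_{i₁} : ℚ]/2` ODD (sextic, decic, …; more generally: the two multiplicities of `Φ_{i₁}`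
> over the member `ψ₀ ∈ Φ_{i₀}` and over `ψ̄₀` differ, `cmFamilyRank_comp_eq_of_quadratic_slot`).  Then deleting the slot `i₀` does not change the rank:
> `rank((Φ_i)_{i ≠ i₀}) = rank((Φ_i)_i)` — indeed `rank(Φ ∘ ε) = rank(Φ)` for EVERY re-indexing `ε : J → I` whose image contains every slot but possibly `i₀`.

MECHANISM (§1, `cmFamilyRank_comp_eq_of_absorb`, pure linear algebra).  `rank(Φ) = dim_ℚ W`, `W = span{𝟙_{τΣ} : τ ∈ Aut(ℂ)} ≤ ℚ^{⊔_i Hom(K_i, ℂ)}`; re-indexing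
along `ε` is the linear map `f ↦ f ∘ (j, s) ↦ (ε j, s)`, which maps `W` ONTO `W_ε` (so `rank(Φ ∘ ε) ≤ rank(Φ)` always: p2's `cmFamilyRank_comp_le`), and it is
INJECTIVE on `W` as soon as the `i₀`-coordinates of every `w ∈ W` are a fixed linear function `L` of its `i₁`-coordinates — which one checks on the generators:
`L(𝟙_{τΦ_{i₁}}) = 𝟙_{τΦ_{i₀}}` for all `τ`.  For a quadratic `k′ ↪ K_{i₁}` (§2, `exists_linearMap_translateInd_eq_of_card_ne`) such an `L` is EXPLICIT: push
forward along the fibres of `Hom(K_{i₁}, ℂ) → Hom(k′, ℂ)` — `(e_* f)(x) = Σ_{φ|_{k′} = x} f(φ)` — so that `e_*(𝟙_{τΦ_{i₁}}) = p·𝟙_{τψ₀} + q·𝟙_{τψ̄₀}` with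
`(p, q)` the multiplicities of `Φ_{i₁}` over `ψ₀ ∈ Φ_{i₀}` and `ψ̄₀`, and subtract `q/|Φ_{i₁}|` times the total mass: `L = (p − q)⁻¹ (e_* − (q/|Φ_{i₁}|) Σ)`.
When `p = q` (balanced signature: `A_{i₁} × E′` of Weil type) nothing is absorbed and the curve splits off instead (b16's foreign-slot criterion does not
apply either; that is the Weil-type world of this engine's headlines).

CONSEQUENCE (next file, `MultiFieldWeilAnyTwoSimpleThreefoldsAnyCurve`): for two simple CM threefolds `T₀`, `T₁` and a CM elliptic curve `E′` with `k′ ↪ K₀`,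
`k′ ↪̸ K₁`: `rank(E′ T₀ T₁) = rank(T₀ T₁) = rank(T₀) + rank(T₁) − 1 = rank(E′ T₀) + rank(T₁) − 1` (b16: two simple threefolds sharing no imaginary quadratic
field are a nondegenerate pair), i.e. the blocks `{E′, T₀} ∣ {T₁}` ARE additive although their slots share a constituent — and the Hodge conjecture for all
`E′^a × T₀^b × T₁^c` follows from gen 31's `E′ × T₀` theorem (mod Markman) and the powers of `T₁`.

[cite: Deligne1982HodgeCycles, I Ex. 3.7 (c)] [cite: Gordon1999HodgeAVSurvey, 7.4–7.6.1 and §3 Theorem (proof)] [cite: MoonenZarhin1999LowDim, Thm. (0.1) (a), §3 (3.1)]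
[cite: Shimura1998, §18.1 and §32.7]

## References
* [Deligne1982HodgeCycles] P. Deligne, *Hodge cycles on abelian varieties*, LNM 900 (1982), I Ex. 3.7.  [Gordon1999HodgeAVSurvey] B. B. Gordon, *A survey of the
  Hodge conjecture for abelian varieties*, §3, 7.4–7.7.  [MoonenZarhin1999LowDim] B. Moonen, Yu. Zarhin, Math. Ann. 315 (1999) 711–733, Thm. (0.1), §3.
  [Shimura1998] G. Shimura, *Abelian varieties with complex multiplication and modular functions*, §18.1, §32.7.

Provenance: Literature home (namespace `Literature.AlgebraicGeometry.ComplexMultiplication.MultiFieldWeil`) of the Summits-side `CorCM/MultiFieldWeilCurveAbsorption` (cell `pub-hodgecm2`, COR-CM; all its imports are `Literature/`, Mathlib and the already re-homed `QuadraticSubfieldFibres`), which `Literature/` may not import; theorems only, no named fact, no definition. Nothing here bears on `HC_CM`. Lane `lit-hodgefound` (Layer A3: CM types, their Kubota ranks and Galois combinatorics), seat p20.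
-/

noncomputable section

open NumberField NumberField.ComplexEmbedding

namespace Literature.AlgebraicGeometry.ComplexMultiplication.MultiFieldWeil

open Literature.AlgebraicGeometry.ComplexMultiplication.QuadraticSubfieldFibres

open Literature.NumberTheory.ComplexMultiplication
open Literature.AlgebraicGeometry.Motives (CMType)
open Literature.AlgebraicGeometry.Pohlmann1968 (IsNondegenerate conjugate_ne_self)
open Literature.AlgebraicGeometry.Pohlmann1968.CMAlgebra

open scoped Classical

/-! ## §1 Re-indexing a family: the rank never grows, and it is unchanged when the dropped slots are absorbed -/

section Absorb

variable {I J : Type} {K : I → Type} [∀ i, Field (K i)]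

/-- Re-indexing the family along `ε : J → I` is, on weights, precomposition with the slot map `(j, s) ↦ (ε j, s)`; it carries the indicator of a translate of
`Σ(Φ)` to the indicator of the same translate of `Σ(Φ ∘ ε)`. [cite: Deligne1982HodgeCycles, I Ex. 3.7 (c) (p. 26)] -/
theorem funLeft_translateInd_familyType (Φ : ∀ i, CMType (K i)) (ε : J → I) (τ : ℂ ≃+* ℂ) :
    LinearMap.funLeft ℚ ℚ (fun x : (j : J) × (K (ε j) →+* ℂ) => (⟨ε x.1, x.2⟩ : (i : I) × (K i →+* ℂ))) (translateInd (familyType Φ) τ) =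
      translateInd (familyType fun j => Φ (ε j)) τ := by
  funext x
  rw [LinearMap.funLeft_apply, translateInd_familyType, translateInd_familyType]

/-- The span of the translates of `Σ(Φ ∘ ε)` is the image of the span of the translates of `Σ(Φ)` under the slot map. [cite: Deligne1982HodgeCycles, I Ex. 3.7 (c) (p. 26)] -/
theorem span_translateInd_familyType_comp (Φ : ∀ i, CMType (K i)) (ε : J → I) :
    Submodule.span ℚ (Set.range fun τ : ℂ ≃+* ℂ => translateInd (familyType fun j => Φ (ε j)) τ) =
      (Submodule.span ℚ (Set.range fun τ : ℂ ≃+* ℂ => translateInd (familyType Φ) τ)).map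
        (LinearMap.funLeft ℚ ℚ (fun x : (j : J) × (K (ε j) →+* ℂ) => (⟨ε x.1, x.2⟩ : (i : I) × (K i →+* ℂ)))) := by
  have hfun : (fun τ : ℂ ≃+* ℂ => translateInd (familyType fun j => Φ (ε j)) τ) =
      LinearMap.funLeft ℚ ℚ (fun x : (j : J) × (K (ε j) →+* ℂ) => (⟨ε x.1, x.2⟩ : (i : I) × (K i →+* ℂ))) ∘
        fun τ : ℂ ≃+* ℂ => translateInd (familyType Φ) τ :=
    funext fun τ => (funLeft_translateInd_familyType Φ ε τ).symm
  rw [hfun, Set.range_comp, Submodule.map_span]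

/-- **ABSORPTION.**  Let `ε : J → I` be a re-indexing whose image contains every slot except possibly `i₀`, and suppose the slot `i₀` is ABSORBED by the slot
`ε j₁`: there is a `ℚ`-linear `L : ℚ^{Hom(K_{ε j₁}, ℂ)} → ℚ^{Hom(K_{i₀}, ℂ)}` with `L(𝟙_{τΦ_{ε j₁}}) = 𝟙_{τΦ_{i₀}}` for every `τ ∈ Aut(ℂ)`.  Then
`rank(Φ ∘ ε) = rank(Φ)`: on the span `W` of the translates of `Σ(Φ)` the `i₀`-coordinates are `L` of the `ε j₁`-coordinates (true on the generators, linear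
in `w`), so the slot map is injective on `W`.  On Mumford–Tate groups: `MT(∏_i A_i) → MT(∏_{i ≠ i₀} A_i)` is an isogeny. [cite: Deligne1982HodgeCycles, I Ex. 3.7 (c)]
[cite: Gordon1999HodgeAVSurvey, 7.4–7.6.1] -/
theorem cmFamilyRank_comp_eq_of_absorb (Φ : ∀ i, CMType (K i)) {i₀ : I} (ε : J → I) (hε : ∀ i, i ≠ i₀ → ∃ j, ε j = i) (j₁ : J)
    (L : ((K (ε j₁) →+* ℂ) → ℚ) →ₗ[ℚ] ((K i₀ →+* ℂ) → ℚ)) (hL : ∀ τ : ℂ ≃+* ℂ, L (translateInd (Φ (ε j₁)).1 τ) = translateInd (Φ i₀).1 τ) :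
    cmFamilyRank (fun j => Φ (ε j)) = cmFamilyRank Φ := by
  -- the slot map and the two coordinate restrictions
  set f := LinearMap.funLeft ℚ ℚ (fun x : (j : J) × (K (ε j) →+* ℂ) => (⟨ε x.1, x.2⟩ : (i : I) × (K i →+* ℂ))) with hf
  set W := Submodule.span ℚ (Set.range fun τ : ℂ ≃+* ℂ => translateInd (familyType Φ) τ) with hW
  let R₀ : (((i : I) × (K i →+* ℂ)) → ℚ) →ₗ[ℚ] ((K i₀ →+* ℂ) → ℚ) := LinearMap.funLeft ℚ ℚ fun s => (⟨i₀, s⟩ : (i : I) × (K i →+* ℂ))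
  let R₁ : (((i : I) × (K i →+* ℂ)) → ℚ) →ₗ[ℚ] ((K (ε j₁) →+* ℂ) → ℚ) := LinearMap.funLeft ℚ ℚ fun s => (⟨ε j₁, s⟩ : (i : I) × (K i →+* ℂ))
  -- on `W` the `i₀`-coordinates are `L` of the `ε j₁`-coordinates
  have key : W ≤ LinearMap.ker (R₀ - L.comp R₁) := by
    refine Submodule.span_le.2 ?_
    rintro _ ⟨τ, rfl⟩
    have h0 : R₀ (translateInd (familyType Φ) τ) = translateInd (Φ i₀).1 τ :=
      funext fun s => by rw [LinearMap.funLeft_apply, translateInd_familyType]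
    have h1 : R₁ (translateInd (familyType Φ) τ) = translateInd (Φ (ε j₁)).1 τ :=
      funext fun s => by rw [LinearMap.funLeft_apply, translateInd_familyType]
    rw [SetLike.mem_coe, LinearMap.mem_ker, LinearMap.sub_apply, LinearMap.comp_apply, h0, h1, hL, sub_self]
  -- hence the slot map is injective on `W`
  have hinj : ∀ w ∈ W, f w = 0 → w = 0 := by
    intro w hw h0
    have hR₁ : R₁ w = 0 := by
      funext s
      have := congrFun h0 ⟨j₁, s⟩
      rw [hf, LinearMap.funLeft_apply] at this
      rw [LinearMap.funLeft_apply]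
      exact this
    have hR₀ : R₀ w = 0 := by
      have hk := key hw
      rw [LinearMap.mem_ker, LinearMap.sub_apply, LinearMap.comp_apply, hR₁, map_zero, sub_zero] at hk
      exact hk
    funext x
    obtain ⟨i, s⟩ := x
    by_cases hi : i = i₀
    · subst hi
      have := congrFun hR₀ s
      rw [LinearMap.funLeft_apply] at this
      exact this
    · obtain ⟨j, rfl⟩ := hε i hi
      have := congrFun h0 ⟨j, s⟩
      rw [hf, LinearMap.funLeft_apply] at this
      exact this
  have hker : LinearMap.ker (f.domRestrict W) = ⊥ :=
    LinearMap.ker_eq_bot'.2 fun w h0 => Subtype.ext (hinj w.1 w.2 (by rw [LinearMap.domRestrict_apply] at h0; exact h0))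
  have hrank := LinearMap.finrank_range_of_inj (LinearMap.ker_eq_bot.1 hker)
  rw [LinearMap.range_domRestrict] at hrank
  unfold cmFamilyRank typeRank
  rw [span_translateInd_familyType_comp, ← hW, ← hf]
  exact hrank

/-- **Absorption through a pair**: if `L(𝟙_{τΦ_{i₁}}) = 𝟙_{τΦ_{i₀}}` for all `τ` then deleting the slot `i₀` — re-indexing along the inclusion of
`{i | i ≠ i₀}` — does not change the rank (`i₁ ≠ i₀`). [cite: Deligne1982HodgeCycles, I Ex. 3.7 (c)] [cite: Gordon1999HodgeAVSurvey, 7.4–7.6.1] -/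
theorem cmFamilyRank_subtype_ne_eq_of_absorb (Φ : ∀ i, CMType (K i)) {i₀ i₁ : I} (h : i₁ ≠ i₀)
    (L : ((K i₁ →+* ℂ) → ℚ) →ₗ[ℚ] ((K i₀ →+* ℂ) → ℚ)) (hL : ∀ τ : ℂ ≃+* ℂ, L (translateInd (Φ i₁).1 τ) = translateInd (Φ i₀).1 τ) :
    cmFamilyRank (fun i : {i : I // i ≠ i₀} => Φ i.1) = cmFamilyRank Φ :=
  cmFamilyRank_comp_eq_of_absorb Φ (fun i : {i : I // i ≠ i₀} => i.1) (fun i hi => ⟨⟨i, hi⟩, rfl⟩) ⟨i₁, h⟩ L hL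

end Absorb

/-! ## §2 The absorbing map of a quadratic subfield: push-forward along the fibres, corrected by the total mass -/

section Quadratic

variable {k L : Type} [Field k] [NumberField k] [Field L] [NumberField L]

/-- **Each fibre of `Hom(K, ℂ) → Hom(k, ℂ)` over a quadratic `k ↪ K` has `[K : ℚ]/2` elements** (the two fibres over `ψ`, `ψ̄` partition `Hom(K, ℂ)` and are
exchanged by conjugation; b16's `card_fibre_eq_three` is the sextic case). [cite: Shimura1998, §18.1] -/
theorem card_fibre_eq_finrank_div_two (Ψ : CMType k) (h2 : Module.finrank ℚ k = 2) (e : k →+* L) (ψ : k →+* ℂ) :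
    (Finset.univ.filter fun s : L →+* ℂ => s.comp e = ψ).card = Module.finrank ℚ L / 2 := by
  have hunion : (Finset.univ.filter fun s : L →+* ℂ => s.comp e = ψ) ∪
      (Finset.univ.filter fun s : L →+* ℂ => s.comp e = conjugate ψ) = Finset.univ := by
    ext s
    simp only [Finset.mem_union, Finset.mem_filter, Finset.mem_univ, true_and, iff_true]
    exact WeilFibre.comp_eq_or_eq_conjugate Ψ h2 e ψ s
  have hdisj : Disjoint (Finset.univ.filter fun s : L →+* ℂ => s.comp e = ψ)
      (Finset.univ.filter fun s : L →+* ℂ => s.comp e = conjugate ψ) := by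
    rw [Finset.disjoint_filter]
    intro s _ h1 h2'
    exact conjugate_ne_self Ψ ψ (h2'.symm.trans h1)
  have hsum := Finset.card_union_of_disjoint hdisj
  rw [hunion, Finset.card_univ, Embeddings.card, ← WeilFibre.card_fibre_eq_card_fibre_conjugate e ψ] at hsum
  omega

/-- **The multiplicities of a CM type over `ψ` and over `ψ̄` add up to `[K : ℚ]/2`**: `φ ↦ φ̄` maps the members of `Θ` over `ψ̄` bijectively onto the non-members
over `ψ` (b16's `card_fibre_mem_add` is the sextic case `= 3`). [cite: Shimura1998, §18.1] -/
theorem card_fibre_mem_add_eq (Ψ : CMType k) (h2 : Module.finrank ℚ k = 2) (e : k →+* L) (Θ : CMType L) (ψ : k →+* ℂ) :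
    (Finset.univ.filter fun s : L →+* ℂ => s.comp e = ψ ∧ s ∈ Θ.1).card +
      (Finset.univ.filter fun s : L →+* ℂ => s.comp e = conjugate ψ ∧ s ∈ Θ.1).card = Module.finrank ℚ L / 2 := by
  have hbij : (Finset.univ.filter fun s : L →+* ℂ => s.comp e = conjugate ψ ∧ s ∈ Θ.1).card =
      (Finset.univ.filter fun s : L →+* ℂ => s.comp e = ψ ∧ s ∉ Θ.1).card := by
    refine Finset.card_nbij' (fun s => conjugate s) (fun s => conjugate s) ?_ ?_ ?_ ?_
    · intro s hs
      simp only [Finset.mem_coe, Finset.mem_filter, Finset.mem_univ, true_and] at hs ⊢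
      refine ⟨by rw [WeilFibre.conjugate_comp, hs.1]; exact ComplexEmbedding.involutive_conjugate k ψ, fun h => ?_⟩
      exact ((Θ.2 s).1 hs.2) h
    · intro s hs
      simp only [Finset.mem_coe, Finset.mem_filter, Finset.mem_univ, true_and] at hs ⊢
      refine ⟨by rw [WeilFibre.conjugate_comp, hs.1], ?_⟩
      by_contra h
      exact hs.2 ((Θ.2 s).2 h)
    · intro s _
      exact ComplexEmbedding.involutive_conjugate L s
    · intro s _
      exact ComplexEmbedding.involutive_conjugate L s
  rw [hbij]
  have hsplit := Finset.card_filter_add_card_filter_not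
    (s := Finset.univ.filter fun s : L →+* ℂ => s.comp e = ψ) (fun s : L →+* ℂ => s ∈ Θ.1)
  rw [Finset.filter_filter, Finset.filter_filter, card_fibre_eq_finrank_div_two Ψ h2 e ψ] at hsplit
  exact hsplit

omit [NumberField L] in
/-- The indicator of a translate of `Θ`, written as an `if`. [cite: Dodson1987, §1.1 (p. 50)] -/
private theorem translateInd_eq_ite (Θ : CMType L) (τ : ℂ ≃+* ℂ) (φ : L →+* ℂ) :
    translateInd Θ.1 τ φ = if (τ : ℂ →+* ℂ).comp φ ∈ Θ.1 then 1 else 0 := by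
  by_cases h : (τ : ℂ →+* ℂ).comp φ ∈ Θ.1
  · rw [if_pos h, translateInd_of_mem (show τ • φ ∈ Θ.1 from h)]
  · rw [if_neg h, translateInd_of_not_mem (show τ • φ ∉ Θ.1 from h)]

omit [NumberField k] in
/-- **Push-forward of a translate along the fibres**: `Σ_{φ|_k = x} 𝟙_{τΘ}(φ) = #{φ′ ∈ Θ | φ′|_k = τ ∘ x}` — the multiplicity of `Θ` over `τ ∘ x`.
[cite: Shimura1998, §18.1] -/
theorem sum_fibre_translateInd_eq (e : k →+* L) (Θ : CMType L) (τ : ℂ ≃+* ℂ) (x : k →+* ℂ) :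
    (∑ φ ∈ Finset.univ.filter (fun φ : L →+* ℂ => φ.comp e = x), translateInd Θ.1 τ φ) =
      ((Finset.univ.filter fun φ : L →+* ℂ => φ.comp e = (τ : ℂ →+* ℂ).comp x ∧ φ ∈ Θ.1).card : ℚ) := by
  simp_rw [translateInd_eq_ite Θ τ]
  rw [Finset.sum_boole, Finset.filter_filter]
  exact_mod_cast congrArg (fun n : ℕ => (n : ℚ)) (WeilFibre.card_fibre_comp_mem_eq e Θ x τ)

/-- **Total mass of a translate**: `Σ_φ 𝟙_{τΘ}(φ) = |Θ|` (a translate of a CM type is a CM type: `φ ↦ τ ∘ φ` is a bijection of `Hom(K, ℂ)` carrying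
`τ⁻¹Θ` onto `Θ`). [cite: Shimura1998, §32.10 (proof)] -/
theorem sum_translateInd_eq_card (Θ : CMType L) (τ : ℂ ≃+* ℂ) :
    (∑ φ : L →+* ℂ, translateInd Θ.1 τ φ) = ((Finset.univ.filter fun φ : L →+* ℂ => φ ∈ Θ.1).card : ℚ) := by
  simp_rw [translateInd_eq_ite Θ τ]
  rw [Finset.sum_boole]
  refine congrArg (fun n : ℕ => (n : ℚ)) (Finset.card_nbij' (fun φ => (τ : ℂ →+* ℂ).comp φ) (fun φ => (τ.symm : ℂ →+* ℂ).comp φ) ?_ ?_ ?_ ?_)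
  · intro φ hφ
    simp only [Finset.mem_coe, Finset.mem_filter, Finset.mem_univ, true_and] at hφ ⊢
    exact hφ
  · intro φ hφ
    simp only [Finset.mem_coe, Finset.mem_filter, Finset.mem_univ, true_and] at hφ ⊢
    have hcomp : (τ : ℂ →+* ℂ).comp ((τ.symm : ℂ →+* ℂ).comp φ) = φ := RingHom.ext fun x => by simp
    rw [hcomp]
    exact hφ
  · intro φ _
    exact RingHom.ext fun x => by simp
  · intro φ _
    exact RingHom.ext fun x => by simp

/-- **THE ABSORBING MAP.**  `k` quadratic with CM type `Ψ ∋ ψ₀`, `e : k ↪ K`, `Θ` a CM type of `K` whose multiplicities `p = #{φ ∈ Θ | φ|_k = ψ₀}` and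
`q = #{φ ∈ Θ | φ|_k = ψ̄₀}` DIFFER.  Then the `ℚ`-linear map `L = (p − q)⁻¹ · (e_* − (q/|Θ|)·Σ)` — push forward along the fibres of `Hom(K, ℂ) → Hom(k, ℂ)`,
minus `q/|Θ|` times the total mass — satisfies `L(𝟙_{τΘ}) = 𝟙_{τΨ}` for EVERY `τ ∈ Aut(ℂ)` (`e_*(𝟙_{τΘ}) = p·𝟙_{τ⁻¹ψ₀…}`: over `x` it counts the members of
`Θ` above `τ ∘ x ∈ {ψ₀, ψ̄₀}`).  This is the index-set form of «`MT(A × E) → MT(A)` is an isogeny when `k ⊂ End⁰(A)` acts with unbalanced multiplicities»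
(Moonen–Zarhin's case (a): `X₁` an elliptic curve with CM by `k ↪ End⁰(X₂)`). [cite: MoonenZarhin1999LowDim, Thm. (0.1) (a), §3 (3.1)] [cite: Shimura1998, §18.1] -/
theorem exists_linearMap_translateInd_eq_of_card_ne (Ψ : CMType k) (h2 : Module.finrank ℚ k = 2) (e : k →+* L) (Θ : CMType L) {ψ₀ : k →+* ℂ}
    (hψ₀ : ψ₀ ∈ Ψ.1)
    (hne : (Finset.univ.filter fun φ : L →+* ℂ => φ.comp e = ψ₀ ∧ φ ∈ Θ.1).card ≠
      (Finset.univ.filter fun φ : L →+* ℂ => φ.comp e = conjugate ψ₀ ∧ φ ∈ Θ.1).card) :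
    ∃ L' : ((L →+* ℂ) → ℚ) →ₗ[ℚ] ((k →+* ℂ) → ℚ), ∀ τ : ℂ ≃+* ℂ, L' (translateInd Θ.1 τ) = translateInd Ψ.1 τ := by
  set p : ℚ := ((Finset.univ.filter fun φ : L →+* ℂ => φ.comp e = ψ₀ ∧ φ ∈ Θ.1).card : ℚ) with hp
  set q : ℚ := ((Finset.univ.filter fun φ : L →+* ℂ => φ.comp e = conjugate ψ₀ ∧ φ ∈ Θ.1).card : ℚ) with hq
  set N : ℚ := ((Finset.univ.filter fun φ : L →+* ℂ => φ ∈ Θ.1).card : ℚ) with hN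
  have hpq : p - q ≠ 0 := by
    rw [hp, hq]
    exact sub_ne_zero.2 (by exact_mod_cast hne)
  have hN0 : N ≠ 0 := by
    rw [hN, Nat.cast_ne_zero, ← pos_iff_ne_zero, Finset.card_pos]
    obtain ⟨φ⟩ : Nonempty (L →+* ℂ) := inferInstance
    by_cases hφ : φ ∈ Θ.1
    · exact ⟨φ, Finset.mem_filter.2 ⟨Finset.mem_univ _, hφ⟩⟩
    · exact ⟨conjugate φ, Finset.mem_filter.2 ⟨Finset.mem_univ _, by
        by_contra h
        exact hφ ((Θ.2 φ).2 h)⟩⟩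
  refine ⟨{ toFun := fun f x => (p - q)⁻¹ * ((∑ φ ∈ Finset.univ.filter (fun φ : L →+* ℂ => φ.comp e = x), f φ) - q / N * ∑ φ, f φ)
            map_add' := fun f f' => by
              funext x
              simp only [Pi.add_apply, Finset.sum_add_distrib]
              ring
            map_smul' := fun a f => by
              funext x
              simp only [Pi.smul_apply, smul_eq_mul, RingHom.id_apply, ← Finset.mul_sum]
              ring }, fun τ => ?_⟩
  funext x
  simp only [LinearMap.coe_mk, AddHom.coe_mk]
  rw [sum_fibre_translateInd_eq e Θ τ x, sum_translateInd_eq_card Θ τ, ← hN, div_mul_cancel₀ _ hN0]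
  rcases WeilFibre.eq_or_eq_conjugate_of_finrank_eq_two Ψ h2 ψ₀ ((τ : ℂ →+* ℂ).comp x) with hx | hx
  · -- over `ψ₀`: multiplicity `p`, and `τ ∘ x = ψ₀ ∈ Ψ`
    rw [hx, ← hp, translateInd_of_mem (show τ • x ∈ Ψ.1 by rw [show τ • x = ψ₀ from hx]; exact hψ₀), inv_mul_cancel₀ hpq]
  · -- over `ψ̄₀`: multiplicity `q`, and `τ ∘ x = ψ̄₀ ∉ Ψ`
    rw [hx, ← hq, sub_self, mul_zero, translateInd_of_not_mem (show τ • x ∉ Ψ.1 by rw [show τ • x = conjugate ψ₀ from hx]; exact (Ψ.2 ψ₀).1 hψ₀)]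

/-- **ODD relative degree ⟹ unbalanced**: if `[K : ℚ]/2` is odd the two multiplicities differ (they add up to `[K : ℚ]/2`), so the absorbing map exists for
EVERY CM type `Θ` of `K` — e.g. `K` sextic (`1 + 2`), decic, of degree `14`, …. [cite: Shimura1998, §18.1] [cite: MoonenZarhin1999LowDim, Thm. (0.1) (a)] -/
theorem exists_linearMap_translateInd_eq_of_odd (Ψ : CMType k) (h2 : Module.finrank ℚ k = 2) (e : k →+* L) (Θ : CMType L)
    (hodd : ¬ 2 ∣ Module.finrank ℚ L / 2) :
    ∃ L' : ((L →+* ℂ) → ℚ) →ₗ[ℚ] ((k →+* ℂ) → ℚ), ∀ τ : ℂ ≃+* ℂ, L' (translateInd Θ.1 τ) = translateInd Ψ.1 τ := by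
  obtain ⟨ψ₀, hψ₀⟩ : ∃ ψ₀ : k →+* ℂ, ψ₀ ∈ Ψ.1 := by
    obtain ⟨ψ⟩ : Nonempty (k →+* ℂ) := inferInstance
    by_cases hψ : ψ ∈ Ψ.1
    · exact ⟨ψ, hψ⟩
    · exact ⟨conjugate ψ, by
        by_contra h
        exact hψ ((Ψ.2 ψ).2 h)⟩
  refine exists_linearMap_translateInd_eq_of_card_ne Ψ h2 e Θ hψ₀ fun hpq => hodd ?_
  have hsum := card_fibre_mem_add_eq Ψ h2 e Θ ψ₀
  rw [hpq] at hsum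
  exact ⟨_, by rw [← hsum, two_mul]⟩

end Quadratic

/-! ## §3 Curve absorption for families of CM types -/

section Family

variable {I J : Type} {K : I → Type} [∀ i, Field (K i)] [∀ i, NumberField (K i)]

/-- **CURVE ABSORPTION, signature form.**  `(Φ_i)_i` CM types, `i₀` a quadratic slot (`[K_{i₀} : ℚ] = 2`), `ε : J → I` a re-indexing reaching every slot but
possibly `i₀`, `j₁` with `e : K_{i₀} ↪ K_{ε j₁}` such that the multiplicities of `Φ_{ε j₁}` over the member `ψ₀ ∈ Φ_{i₀}` and over `ψ̄₀` differ.  Then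
`rank(Φ ∘ ε) = rank(Φ)` — the curve slot adds nothing to the Mumford–Tate rank. [cite: MoonenZarhin1999LowDim, Thm. (0.1) (a), §3 (3.1)]
[cite: Deligne1982HodgeCycles, I Ex. 3.7 (c)] -/
theorem cmFamilyRank_comp_eq_of_quadratic_slot (Φ : ∀ i, CMType (K i)) {i₀ : I} (h2 : Module.finrank ℚ (K i₀) = 2) (ε : J → I)
    (hε : ∀ i, i ≠ i₀ → ∃ j, ε j = i) (j₁ : J) (e : K i₀ →+* K (ε j₁)) {ψ₀ : K i₀ →+* ℂ} (hψ₀ : ψ₀ ∈ (Φ i₀).1)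
    (hne : (Finset.univ.filter fun φ : K (ε j₁) →+* ℂ => φ.comp e = ψ₀ ∧ φ ∈ (Φ (ε j₁)).1).card ≠
      (Finset.univ.filter fun φ : K (ε j₁) →+* ℂ => φ.comp e = conjugate ψ₀ ∧ φ ∈ (Φ (ε j₁)).1).card) :
    cmFamilyRank (fun j => Φ (ε j)) = cmFamilyRank Φ := by
  obtain ⟨L, hL⟩ := exists_linearMap_translateInd_eq_of_card_ne (Φ i₀) h2 e (Φ (ε j₁)) hψ₀ hne
  exact cmFamilyRank_comp_eq_of_absorb Φ ε hε j₁ L hL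

/-- **CURVE ABSORPTION, odd-degree form.**  `(Φ_i)_i` CM types, `i₀` a quadratic slot, `ε : J → I` a re-indexing reaching every slot but possibly `i₀`, and
`e : K_{i₀} ↪ K_{ε j₁}` with `[K_{ε j₁} : ℚ]/2` ODD (a sextic, decic, … member through the imaginary quadratic field `K_{i₀}`).  Then `rank(Φ ∘ ε) = rank(Φ)`,
WHATEVER the types: `dim MT(∏_i A_i) = dim MT(∏_{i ≠ i₀} A_i)`. [cite: MoonenZarhin1999LowDim, Thm. (0.1) (a), §3 (3.1)] [cite: Deligne1982HodgeCycles, I Ex. 3.7 (c)] -/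
theorem cmFamilyRank_comp_eq_of_quadratic_slot_of_odd (Φ : ∀ i, CMType (K i)) {i₀ : I} (h2 : Module.finrank ℚ (K i₀) = 2) (ε : J → I)
    (hε : ∀ i, i ≠ i₀ → ∃ j, ε j = i) (j₁ : J) (e : K i₀ →+* K (ε j₁)) (hodd : ¬ 2 ∣ Module.finrank ℚ (K (ε j₁)) / 2) :
    cmFamilyRank (fun j => Φ (ε j)) = cmFamilyRank Φ := by
  obtain ⟨L, hL⟩ := exists_linearMap_translateInd_eq_of_odd (Φ i₀) h2 e (Φ (ε j₁)) hodd
  exact cmFamilyRank_comp_eq_of_absorb Φ ε hε j₁ L hL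

/-- **Deleting an absorbed curve slot**: with `i₁ ≠ i₀`, `[K_{i₀} : ℚ] = 2`, `K_{i₀} ↪ K_{i₁}` and `[K_{i₁} : ℚ]/2` odd,
`rank((Φ_i)_{i ≠ i₀}) = rank((Φ_i)_i)`. [cite: MoonenZarhin1999LowDim, Thm. (0.1) (a), §3 (3.1)] [cite: Deligne1982HodgeCycles, I Ex. 3.7 (c)] -/
theorem cmFamilyRank_subtype_ne_eq_of_quadratic_slot_of_odd (Φ : ∀ i, CMType (K i)) {i₀ i₁ : I} (h : i₁ ≠ i₀) (h2 : Module.finrank ℚ (K i₀) = 2)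
    (e : K i₀ →+* K i₁) (hodd : ¬ 2 ∣ Module.finrank ℚ (K i₁) / 2) :
    cmFamilyRank (fun i : {i : I // i ≠ i₀} => Φ i.1) = cmFamilyRank Φ := by
  obtain ⟨L, hL⟩ := exists_linearMap_translateInd_eq_of_odd (Φ i₀) h2 e (Φ i₁) hodd
  exact cmFamilyRank_subtype_ne_eq_of_absorb Φ h L hL

/-- **The rank of a one-member family with a nondegenerate type** is `[K : ℚ]/2 + 1` (`dim A + 1`). [cite: Gordon1999HodgeAVSurvey, 7.5 (3) and 7.6.1]
[cite: Dodson1987, §1.1 (p. 51)] -/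
theorem cmFamilyRank_eq_of_isNondegenerate_of_unique [∀ i, IsCMField (K i)] [Unique I] (Φ : ∀ i, CMType (K i)) (hΦ : IsNondegenerate (Φ default)) :
    cmFamilyRank Φ = Module.finrank ℚ (K default) / 2 + 1 := by
  have h := (isNondegenerateFamily_iff_isNondegenerate Φ).2 hΦ
  rw [isNondegenerateFamily_iff, Fintype.sum_unique] at h
  exact h

end Family

end Literature.AlgebraicGeometry.ComplexMultiplication.MultiFieldWeil

end
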